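import Summits.CriticalPhenomena.PercolationContinuityZ3.Theorems.PercGamblersRuinVerticalGamblersRuinStubClusterComparison
import Summits.CriticalPhenomena.PercolationContinuityZ3.Theorems.PercGamblersRuinVerticalGamblersRuinStubGoodPlateOfNoDrift

/-!
# Route `PercGamblersRuin`, crux `VerticalGamblersRuin` (stmt-CriticalPhenomena-10642):
# stub `stub_stationarity` — stationarity of the degree-biased cluster law under the SRW kernel

Helper file for the stub `stub_stationarity` of the line `registered` (skeleton rev 7, the
deterministic-time criterion) of the crux `PercGamblersRuin.VerticalGamblersRuin`.

Setting: bond configurations `ω` on `ℤ³` under `P = P_{p_c}`; `N_ω(x)` is the set of lattice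
neighbours `y ∼ x` with `s(x, y)` open in `ω`, `deg_ω(0) = #N_ω(0)`; the averaging operator of
the simple random walk on the open edges is `(𝒫_ω g)(x) = (∑_{y ∈ N_ω(x)} g y) / #N_ω(x)`
(`0 / 0 = 0`), entering the statement as a universally quantified `Pop` pinned by its formula; the
configuration seen from `x` is `ω - x = BondConfig.relabel (sym2Equiv (Site.shift (-x))) ω`.

Statement proved (exact registered signature): for every `T : ℕ` and measurable `f : Ω → [0, 1]`,
`∫_{0 ↔ ∞} deg_ω(0) · (𝒫_ω^[T] (x ↦ f (ω - x)))(0) dP = ∫_{0 ↔ ∞} deg_ω(0) · f(ω) dP`, i.e. the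
degree-biased cluster law `deg_ω(0) · 1_{0 ↔ ∞} · P` is stationary for the chain "environment
seen from the walker" (De Masi–Ferrari–Goldstein–Wick 1989, §4).

Proof.  ONE STEP: `deg_ω(0) · (𝒫_ω g)(0) = ∑_{y ∼ 0} 1_{s(0,y) ∈ ω} g(y)`; for a lattice neighbour
`y` of `0`, `∫_{0↔∞} 1_{s(0,y) ∈ ω} f(ω - y) dP(ω) = ∫_{0↔∞} 1_{s(-y,0) ∈ ω'} f(ω') dP(ω')`
(substitute `ω = ω' + y`, translation invariance `bondPercolation_map_shift`;
`ω' + y ∈ {0 ↔ ∞} ↔ ω' ∈ {-y ↔ ∞}`, `relabel_mem_percolatesAt_iff`; on `{s(-y, 0) ∈ ω'}` the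
clusters of `-y` and `0` coincide, `StubClusterComparison.mem_percolatesAt_iff_of_mem_filter`);
summing over `y ∼ 0` and reindexing `y ↦ -y` gives `∫_{0↔∞} deg·(𝒫 F_ω)(0) = ∫_{0↔∞} deg·f` for
`F_ω(x) = f(ω - x)`.  SHIFT COVARIANCE: `(𝒫_ω F_ω)(y) = (𝒫_{ω-y} F_{ω-y})(0)`
(`N_ω(y) = N_{ω-y}(0) + y`, `(ω - y) - z = ω - (z + y)`).  INDUCTION on `T` generalizing `f`:
`𝒫^[T+1] F_ω = 𝒫^[T] (x ↦ H(ω - x))` with `H(ω') = (𝒫_{ω'} F_{ω'})(0)` measurable and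
`[0, 1]`-valued; apply the induction hypothesis to `H` and the one-step identity (`ω - 0 = ω`).

## References

* A. De Masi, P. A. Ferrari, S. Goldstein, W. D. Wick, *An invariance principle for reversible
  Markov processes. Applications to random motions in random environments*, J. Statist. Phys.
  55 (1989), 787–855, §4 (stationarity of the environment seen from the walker on the cluster).
* G. Grimmett, *Percolation*, 2nd ed., Springer (1999), §1.6 (translation invariance of `P_p`).
-/

noncomputable section

namespace Summit.CriticalPhenomena.PercolationContinuityZ3.Theorems.VerticalGamblersRuin

open MeasureTheory Filter Topology
open Literature.Probability.Percolation Literature.Probability.LatticeModels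
open scoped Classical

namespace StubStationarity

/-! ### Configurations seen from a site, `ω - x = BondConfig.relabel (sym2Equiv (shift (-x))) ω` -/

/-- Open edges of the configuration seen from `x`: `s(a, b) ∈ ω - x ↔ s(a + x, b + x) ∈ ω`. -/
theorem mk_mem_relabel_shift_neg_iff (x : Site 3) (ω : BondConfig (Site 3)) (a b : Site 3) :
    s(a, b) ∈ BondConfig.relabel (sym2Equiv (Site.shift (-x))) ω ↔ s(a + x, b + x) ∈ ω := by
  have h := mk_add_mem_relabel_shift_iff (-x) ω (a + x) (b + x)
  rwa [add_neg_cancel_right, add_neg_cancel_right] at h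

/-- Seeing `ω` from `y` and then from `z` is seeing it from `z + y`: `(ω - y) - z = ω - (z + y)`. -/
theorem relabel_shift_neg_relabel_shift_neg (z y : Site 3) (ω : BondConfig (Site 3)) :
    BondConfig.relabel (sym2Equiv (Site.shift (-z)))
        (BondConfig.relabel (sym2Equiv (Site.shift (-y))) ω) =
      BondConfig.relabel (sym2Equiv (Site.shift (-(z + y)))) ω := by
  ext e
  induction e using Sym2.ind with
  | h a b => simp only [mk_mem_relabel_shift_neg_iff, add_assoc]

/-- Shifting by `y` and then looking from `y` gives back the configuration: `(ω' + y) - y = ω'`. -/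
theorem relabel_shift_neg_relabel_shift (y : Site 3) (ω' : BondConfig (Site 3)) :
    BondConfig.relabel (sym2Equiv (Site.shift (-y)))
        (BondConfig.relabel (sym2Equiv (Site.shift y)) ω') = ω' := by
  ext e
  induction e using Sym2.ind with
  | h a b => rw [mk_mem_relabel_shift_neg_iff, mk_add_mem_relabel_shift_iff]

/-- The configuration seen from the origin is the configuration itself: `ω - 0 = ω`. -/
theorem relabel_shift_neg_zero (ω : BondConfig (Site 3)) :
    BondConfig.relabel (sym2Equiv (Site.shift (-(0 : Site 3)))) ω = ω := by
  ext e
  induction e using Sym2.ind with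
  | h a b => rw [mk_mem_relabel_shift_neg_iff, add_zero, add_zero]

/-! ### Lattice neighbours of the origin -/

/-- `-y ∼ 0` iff `0 ∼ y` in `ℤ³` (translate the edge by `-y`). -/
theorem zdGraph_adj_neg_zero_iff (y : Site 3) :
    (zdGraph 3).Adj (-y) 0 ↔ (zdGraph 3).Adj 0 y := by
  have h := zdGraph_adj_shift_iff (-y) (0 : Site 3) y
  rwa [Site.shift_apply, Site.shift_apply, zero_add, add_neg_cancel] at h

/-- Open lattice neighbours of `0` in `ω - y` correspond under `z ↦ z + y` to those of `y` in `ω`.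
-/
theorem mem_filter_relabel_shift_neg_iff (y : Site 3) (ω : BondConfig (Site 3)) (z : Site 3) :
    z ∈ ((zdGraph 3).neighborFinset (0 : Site 3)).filter
        (fun z => s((0 : Site 3), z) ∈ BondConfig.relabel (sym2Equiv (Site.shift (-y))) ω) ↔
      Site.shift y z ∈ ((zdGraph 3).neighborFinset y).filter (fun z => s(y, z) ∈ ω) := by
  have hadj : (zdGraph 3).Adj (0 + y) (z + y) ↔ (zdGraph 3).Adj 0 z := zdGraph_adj_shift_iff y 0 z
  rw [zero_add] at hadj
  have hmem : s((0 : Site 3), z) ∈ BondConfig.relabel (sym2Equiv (Site.shift (-y))) ω ↔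
      s(y, z + y) ∈ ω := by
    rw [mk_mem_relabel_shift_neg_iff, zero_add]
  simp only [Finset.mem_filter, SimpleGraph.mem_neighborFinset, Site.shift_apply, hadj, hmem]

/-- **Counting the open edges at the origin through `y ↦ -y`.**
`deg_ω(0) · c = ∑_{y ∼ 0} 1_{s(-y, 0) ∈ ω} c`. -/
theorem card_mul_eq_sum_neg (ω : BondConfig (Site 3)) (c : ℝ) :
    ((((zdGraph 3).neighborFinset (0 : Site 3)).filter
        (fun y => s((0 : Site 3), y) ∈ ω)).card : ℝ) * c =
      ∑ y ∈ (zdGraph 3).neighborFinset (0 : Site 3), if s(-y, (0 : Site 3)) ∈ ω then c else 0 := by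
  rw [← nsmul_eq_mul, ← Finset.sum_const, Finset.sum_filter]
  refine Finset.sum_equiv (Equiv.neg (Site 3)) (fun y => ?_) (fun y _ => ?_)
  · rw [SimpleGraph.mem_neighborFinset, SimpleGraph.mem_neighborFinset, Equiv.neg_apply,
      ← zdGraph_adj_neg_zero_iff y]
    exact (zdGraph 3).adj_comm _ _
  · rw [Equiv.neg_apply, neg_neg, Sym2.eq_swap]

/-! ### Measurability and integrability -/

/-- The number of open lattice edges at the origin is a measurable function of the configuration
(a finite sum of indicators of one-edge events, `card_mul_eq_sum_neg`). -/
theorem measurable_card_filter_zero :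
    Measurable fun ω : BondConfig (Site 3) =>
      ((((zdGraph 3).neighborFinset (0 : Site 3)).filter
        (fun y => s((0 : Site 3), y) ∈ ω)).card : ℝ) := by
  have h : (fun ω : BondConfig (Site 3) => ((((zdGraph 3).neighborFinset (0 : Site 3)).filter
      (fun y => s((0 : Site 3), y) ∈ ω)).card : ℝ)) =
      fun ω => ∑ y ∈ (zdGraph 3).neighborFinset (0 : Site 3),
        if s(-y, (0 : Site 3)) ∈ ω then (1 : ℝ) else 0 :=
    funext fun ω => (mul_one _).symm.trans (card_mul_eq_sum_neg ω 1)
  rw [h]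
  refine Finset.measurable_sum _ fun y _ => ?_
  exact Measurable.ite (measurableSet_mem (s(-y, (0 : Site 3)) : Sym2 (Site 3))) measurable_const
    measurable_const

/-- A measurable `[0, 1]`-valued function of the configuration is integrable for every finite
measure. -/
theorem integrable_of_bounds {g : BondConfig (Site 3) → ℝ} (hg : Measurable g)
    (hb : ∀ ω, 0 ≤ g ω ∧ g ω ≤ 1) (μ : Measure (BondConfig (Site 3))) [IsFiniteMeasure μ] :
    Integrable g μ :=
  Integrable.of_bound hg.aestronglyMeasurable 1 (Eventually.of_forall fun ω => by
    rw [Real.norm_eq_abs, abs_of_nonneg (hb ω).1]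
    exact (hb ω).2)

/-- For measurable `f`, the function `ω ↦ 1_{s(0,y) ∈ ω} f(ω - y)` is measurable. -/
theorem measurable_ite_relabel {f : BondConfig (Site 3) → ℝ} (hf : Measurable f) (y : Site 3) :
    Measurable fun ω : BondConfig (Site 3) =>
      if s((0 : Site 3), y) ∈ ω then f (BondConfig.relabel (sym2Equiv (Site.shift (-y))) ω)
      else 0 :=
  Measurable.ite (measurableSet_mem (s((0 : Site 3), y) : Sym2 (Site 3)))
    (hf.comp (BondConfig.relabel (sym2Equiv (Site.shift (-y)))).measurable) measurable_const

/-! ### The averaging operator: one step at the origin, shift covariance -/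

/-- **One step, pointwise.** `deg_ω(0) · (𝒫_ω g)(0) = ∑_{y ∼ 0} 1_{s(0,y) ∈ ω} g(y)` (if `0` has no
open neighbour both sides vanish, `0 / 0 = 0`). -/
theorem card_mul_pop_zero {Pop : BondConfig (Site 3) → (Site 3 → ℝ) → Site 3 → ℝ}
    (hPop : ∀ ω (g : Site 3 → ℝ) (x : Site 3), Pop ω g x =
      (∑ y ∈ ((zdGraph 3).neighborFinset x).filter (fun y => s(x, y) ∈ ω), g y) /
        ((((zdGraph 3).neighborFinset x).filter (fun y => s(x, y) ∈ ω)).card : ℝ))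
    (ω : BondConfig (Site 3)) (g : Site 3 → ℝ) :
    ((((zdGraph 3).neighborFinset (0 : Site 3)).filter
        (fun y => s((0 : Site 3), y) ∈ ω)).card : ℝ) * Pop ω g 0 =
      ∑ y ∈ (zdGraph 3).neighborFinset (0 : Site 3), if s((0 : Site 3), y) ∈ ω then g y else 0 := by
  rw [hPop, ← Finset.sum_filter]
  rcases eq_or_ne ((((zdGraph 3).neighborFinset (0 : Site 3)).filter
      (fun y => s((0 : Site 3), y) ∈ ω)).card : ℝ) 0 with hc | hc
  · have h0 : ((zdGraph 3).neighborFinset (0 : Site 3)).filter (fun y => s((0 : Site 3), y) ∈ ω) =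
        ∅ := Finset.card_eq_zero.1 (Nat.cast_eq_zero.1 hc)
    rw [hc, zero_mul, h0, Finset.sum_empty]
  · exact mul_div_cancel₀ _ hc

/-- **Shift covariance of the averaging operator** applied to `F_ω(x) = f(ω - x)`:
`(𝒫_ω F_ω)(y) = (𝒫_{ω - y} F_{ω - y})(0)` (reindex the open neighbours of `y` in `ω` as the open
neighbours of `0` in `ω - y` shifted by `y`, and `(ω - y) - z = ω - (z + y)`). -/
theorem pop_seen_from {Pop : BondConfig (Site 3) → (Site 3 → ℝ) → Site 3 → ℝ}
    (hPop : ∀ ω (g : Site 3 → ℝ) (x : Site 3), Pop ω g x =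
      (∑ y ∈ ((zdGraph 3).neighborFinset x).filter (fun y => s(x, y) ∈ ω), g y) /
        ((((zdGraph 3).neighborFinset x).filter (fun y => s(x, y) ∈ ω)).card : ℝ))
    (f : BondConfig (Site 3) → ℝ) (ω : BondConfig (Site 3)) (y : Site 3) :
    Pop ω (fun x => f (BondConfig.relabel (sym2Equiv (Site.shift (-x))) ω)) y =
      Pop (BondConfig.relabel (sym2Equiv (Site.shift (-y))) ω)
        (fun x => f (BondConfig.relabel (sym2Equiv (Site.shift (-x)))
          (BondConfig.relabel (sym2Equiv (Site.shift (-y))) ω))) 0 := by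
  have hsum : ∑ z ∈ ((zdGraph 3).neighborFinset (0 : Site 3)).filter
      (fun z => s((0 : Site 3), z) ∈ BondConfig.relabel (sym2Equiv (Site.shift (-y))) ω),
        f (BondConfig.relabel (sym2Equiv (Site.shift (-z)))
          (BondConfig.relabel (sym2Equiv (Site.shift (-y))) ω)) =
      ∑ z ∈ ((zdGraph 3).neighborFinset y).filter (fun z => s(y, z) ∈ ω),
        f (BondConfig.relabel (sym2Equiv (Site.shift (-z))) ω) :=
    Finset.sum_equiv (Site.shift y) (fun z => mem_filter_relabel_shift_neg_iff y ω z)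
      (fun z _ => by rw [relabel_shift_neg_relabel_shift_neg, Site.shift_apply])
  have hcard : (((zdGraph 3).neighborFinset (0 : Site 3)).filter
      (fun z => s((0 : Site 3), z) ∈ BondConfig.relabel (sym2Equiv (Site.shift (-y))) ω)).card =
      (((zdGraph 3).neighborFinset y).filter (fun z => s(y, z) ∈ ω)).card :=
    Finset.card_equiv (Site.shift y) (fun z => mem_filter_relabel_shift_neg_iff y ω z)
  rw [hPop, hPop, hsum, hcard]

/-- `(𝒫_ω F_ω)(0)` is a measurable function of `ω` for `F_ω(x) = f(ω - x)`, `f` measurable. -/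
theorem measurable_pop_zero {Pop : BondConfig (Site 3) → (Site 3 → ℝ) → Site 3 → ℝ}
    (hPop : ∀ ω (g : Site 3 → ℝ) (x : Site 3), Pop ω g x =
      (∑ y ∈ ((zdGraph 3).neighborFinset x).filter (fun y => s(x, y) ∈ ω), g y) /
        ((((zdGraph 3).neighborFinset x).filter (fun y => s(x, y) ∈ ω)).card : ℝ))
    {f : BondConfig (Site 3) → ℝ} (hf : Measurable f) :
    Measurable fun ω =>
      Pop ω (fun x => f (BondConfig.relabel (sym2Equiv (Site.shift (-x))) ω)) 0 := by
  simp only [hPop]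
  refine Measurable.div ?_ measurable_card_filter_zero
  have h : (fun ω : BondConfig (Site 3) =>
      ∑ y ∈ ((zdGraph 3).neighborFinset (0 : Site 3)).filter (fun y => s((0 : Site 3), y) ∈ ω),
        f (BondConfig.relabel (sym2Equiv (Site.shift (-y))) ω)) =
      fun ω => ∑ y ∈ (zdGraph 3).neighborFinset (0 : Site 3),
        if s((0 : Site 3), y) ∈ ω then f (BondConfig.relabel (sym2Equiv (Site.shift (-y))) ω)
        else 0 := by
    funext ω
    rw [Finset.sum_filter]
  rw [h]
  exact Finset.measurable_sum _ fun y _ => measurable_ite_relabel hf y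

/-- `(𝒫_ω F_ω)(0) ∈ [0, 1]` for `F_ω(x) = f(ω - x)`, `f` `[0, 1]`-valued. -/
theorem pop_zero_mem_Icc {Pop : BondConfig (Site 3) → (Site 3 → ℝ) → Site 3 → ℝ}
    (hPop : ∀ ω (g : Site 3 → ℝ) (x : Site 3), Pop ω g x =
      (∑ y ∈ ((zdGraph 3).neighborFinset x).filter (fun y => s(x, y) ∈ ω), g y) /
        ((((zdGraph 3).neighborFinset x).filter (fun y => s(x, y) ∈ ω)).card : ℝ))
    {f : BondConfig (Site 3) → ℝ} (hb : ∀ ω, 0 ≤ f ω ∧ f ω ≤ 1) (ω : BondConfig (Site 3)) :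
    0 ≤ Pop ω (fun x => f (BondConfig.relabel (sym2Equiv (Site.shift (-x))) ω)) 0 ∧
      Pop ω (fun x => f (BondConfig.relabel (sym2Equiv (Site.shift (-x))) ω)) 0 ≤ 1 := by
  rw [hPop]
  refine ⟨div_nonneg (Finset.sum_nonneg fun y _ => (hb _).1) (Nat.cast_nonneg _), ?_⟩
  refine div_le_one_of_le₀ ((Finset.sum_le_sum fun y _ => (hb _).2).trans_eq ?_) (Nat.cast_nonneg _)
  rw [Finset.sum_const, nsmul_eq_mul, mul_one]

/-! ### The one-step identity -/

/-- **Translation step** for a lattice neighbour `y` of `0`: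
`∫_{0↔∞} 1_{s(0,y) ∈ ω} f(ω - y) dP(ω) = ∫_{0↔∞} 1_{s(-y,0) ∈ ω'} f(ω') dP(ω')`.  Substitute
`ω = ω' + y` (translation invariance of `P_{p_c}`), then use that on `{s(-y, 0) ∈ ω'}` the events
`{-y ↔ ∞}` and `{0 ↔ ∞}` coincide. -/
theorem setIntegral_ite_relabel (f : BondConfig (Site 3) → ℝ) {y : Site 3}
    (hy : (zdGraph 3).Adj (0 : Site 3) y) :
    ∫ ω in percolatesAt (0 : Site 3),
        (if s((0 : Site 3), y) ∈ ω then f (BondConfig.relabel (sym2Equiv (Site.shift (-y))) ω)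
          else 0) ∂(bondPercolation (zdGraph 3) (criticalProbI 3)) =
      ∫ ω in percolatesAt (0 : Site 3), (if s(-y, (0 : Site 3)) ∈ ω then f ω else 0)
        ∂(bondPercolation (zdGraph 3) (criticalProbI 3)) := by
  have hmp : MeasurePreserving (BondConfig.relabel (sym2Equiv (Site.shift y)))
      (bondPercolation (zdGraph 3) (criticalProbI 3))
      (bondPercolation (zdGraph 3) (criticalProbI 3)) :=
    ⟨(BondConfig.relabel (sym2Equiv (Site.shift y))).measurable, bondPercolation_map_shift y _⟩
  have h := hmp.setIntegral_preimage_emb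
    (BondConfig.relabel (sym2Equiv (Site.shift y))).measurableEmbedding
    (fun ω => if s((0 : Site 3), y) ∈ ω then
      f (BondConfig.relabel (sym2Equiv (Site.shift (-y))) ω) else 0)
    (percolatesAt (0 : Site 3))
  rw [← h]
  have hpre : BondConfig.relabel (sym2Equiv (Site.shift y)) ⁻¹' percolatesAt (0 : Site 3) =
      percolatesAt (-y) := by
    ext ω'
    simpa only [Set.mem_preimage, Site.shift_apply, neg_add_cancel] using
      relabel_mem_percolatesAt_iff (Site.shift y) ω' (-y)
  have hint : ∀ ω' : BondConfig (Site 3),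
      (if s((0 : Site 3), y) ∈ BondConfig.relabel (sym2Equiv (Site.shift y)) ω' then
        f (BondConfig.relabel (sym2Equiv (Site.shift (-y)))
          (BondConfig.relabel (sym2Equiv (Site.shift y)) ω')) else 0) =
      if s(-y, (0 : Site 3)) ∈ ω' then f ω' else 0 := by
    intro ω'
    have he := mk_add_mem_relabel_shift_iff y ω' (-y) 0
    rw [neg_add_cancel, zero_add] at he
    rw [relabel_shift_neg_relabel_shift]
    exact if_congr he rfl rfl
  rw [hpre]
  simp only [hint]
  rw [← integral_indicator (measurableSet_percolatesAt_holds (-y)),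
    ← integral_indicator (measurableSet_percolatesAt_holds (0 : Site 3))]
  refine integral_congr_ae (Eventually.of_forall fun ω' => ?_)
  simp only [Set.indicator_apply]
  by_cases he : s(-y, (0 : Site 3)) ∈ ω'
  · have hiff : ω' ∈ percolatesAt (-y) ↔ ω' ∈ percolatesAt (0 : Site 3) :=
      StubClusterComparison.mem_percolatesAt_iff_of_mem_filter (Finset.mem_filter.2
        ⟨(SimpleGraph.mem_neighborFinset _ _ _).2 ((zdGraph_adj_neg_zero_iff y).2 hy), he⟩)
    by_cases h0 : ω' ∈ percolatesAt (0 : Site 3)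
    · rw [if_pos h0, if_pos (hiff.2 h0)]
    · rw [if_neg h0, if_neg (fun h' => h0 (hiff.1 h'))]
  · rw [if_neg he, ite_self, ite_self]

/-- **One step, integrated.** For measurable `f : Ω → [0, 1]`:
`∫_{0↔∞} ∑_{y ∼ 0} 1_{s(0,y) ∈ ω} f(ω - y) dP = ∫_{0↔∞} deg_ω(0) · f(ω) dP` (sum the translation
steps over the lattice neighbours of `0` and count the open edges at `0` through `y ↦ -y`). -/
theorem setIntegral_sum_ite (f : BondConfig (Site 3) → ℝ) (hf : Measurable f)
    (hb : ∀ ω, 0 ≤ f ω ∧ f ω ≤ 1) :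
    ∫ ω in percolatesAt (0 : Site 3),
        (∑ y ∈ (zdGraph 3).neighborFinset (0 : Site 3),
          if s((0 : Site 3), y) ∈ ω then f (BondConfig.relabel (sym2Equiv (Site.shift (-y))) ω)
          else 0) ∂(bondPercolation (zdGraph 3) (criticalProbI 3)) =
      ∫ ω in percolatesAt (0 : Site 3),
        ((((zdGraph 3).neighborFinset (0 : Site 3)).filter
            (fun y => s((0 : Site 3), y) ∈ ω)).card : ℝ) * f ω
        ∂(bondPercolation (zdGraph 3) (criticalProbI 3)) := by
  have hR : (fun ω : BondConfig (Site 3) => ((((zdGraph 3).neighborFinset (0 : Site 3)).filter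
      (fun y => s((0 : Site 3), y) ∈ ω)).card : ℝ) * f ω) =
      fun ω => ∑ y ∈ (zdGraph 3).neighborFinset (0 : Site 3),
        if s(-y, (0 : Site 3)) ∈ ω then f ω else 0 :=
    funext fun ω => card_mul_eq_sum_neg ω (f ω)
  have hint1 : ∀ y ∈ (zdGraph 3).neighborFinset (0 : Site 3),
      Integrable (fun ω : BondConfig (Site 3) => if s((0 : Site 3), y) ∈ ω then
        f (BondConfig.relabel (sym2Equiv (Site.shift (-y))) ω) else 0)
        ((bondPercolation (zdGraph 3) (criticalProbI 3)).restrict (percolatesAt (0 : Site 3))) :=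
    fun y _ => integrable_of_bounds (measurable_ite_relabel hf y)
      (fun ω => by split_ifs <;> [exact hb _; exact ⟨le_rfl, zero_le_one⟩]) _
  have hint2 : ∀ y ∈ (zdGraph 3).neighborFinset (0 : Site 3),
      Integrable (fun ω : BondConfig (Site 3) => if s(-y, (0 : Site 3)) ∈ ω then f ω else 0)
        ((bondPercolation (zdGraph 3) (criticalProbI 3)).restrict (percolatesAt (0 : Site 3))) :=
    fun y _ => integrable_of_bounds (Measurable.ite (measurableSet_mem (s(-y, (0 : Site 3)) :
      Sym2 (Site 3))) hf measurable_const)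
        (fun ω => by split_ifs <;> [exact hb ω; exact ⟨le_rfl, zero_le_one⟩]) _
  rw [hR, integral_finsetSum _ hint1, integral_finsetSum _ hint2]
  exact Finset.sum_congr rfl fun y hy =>
    setIntegral_ite_relabel f ((SimpleGraph.mem_neighborFinset _ _ _).1 hy)

/-! ### Induction on the number of steps -/

/-- **Stationarity, all times.** For the averaging operator `𝒫_ω` (hypothesis `hPop`), every
`T : ℕ` and every measurable `f : Ω → [0, 1]`:
`∫_{0↔∞} deg_ω(0) · (𝒫_ω^[T] (x ↦ f(ω - x)))(0) dP = ∫_{0↔∞} deg_ω(0) · f(ω) dP`.  Induction on `T`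
generalizing `f`: `𝒫^[T+1] F_ω = 𝒫^[T] (x ↦ H(ω - x))` with `H(ω') = (𝒫_{ω'} F_{ω'})(0)`
(`pop_seen_from`), the induction hypothesis for `H`, and the one-step identity. -/
theorem setIntegral_card_mul_iterate {Pop : BondConfig (Site 3) → (Site 3 → ℝ) → Site 3 → ℝ}
    (hPop : ∀ ω (g : Site 3 → ℝ) (x : Site 3), Pop ω g x =
      (∑ y ∈ ((zdGraph 3).neighborFinset x).filter (fun y => s(x, y) ∈ ω), g y) /
        ((((zdGraph 3).neighborFinset x).filter (fun y => s(x, y) ∈ ω)).card : ℝ)) (T : ℕ) :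
    ∀ f : BondConfig (Site 3) → ℝ, Measurable f → (∀ ω, 0 ≤ f ω ∧ f ω ≤ 1) →
      ∫ ω in percolatesAt (0 : Site 3),
          ((((zdGraph 3).neighborFinset (0 : Site 3)).filter
              (fun y => s((0 : Site 3), y) ∈ ω)).card : ℝ) *
            ((Pop ω)^[T] (fun x => f (BondConfig.relabel (sym2Equiv (Site.shift (-x))) ω))) 0
          ∂(bondPercolation (zdGraph 3) (criticalProbI 3)) =
        ∫ ω in percolatesAt (0 : Site 3),
          ((((zdGraph 3).neighborFinset (0 : Site 3)).filter
              (fun y => s((0 : Site 3), y) ∈ ω)).card : ℝ) * f ω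
          ∂(bondPercolation (zdGraph 3) (criticalProbI 3)) := by
  induction T with
  | zero =>
    intro f hf hb
    simp only [Function.iterate_zero, id_eq, relabel_shift_neg_zero]
  | succ T ih =>
    intro f hf hb
    -- shift covariance: `𝒫_ω F_ω = x ↦ H(ω - x)` with `H ω' = (𝒫_{ω'} F_{ω'})(0)`
    have hstep : ∀ ω : BondConfig (Site 3),
        Pop ω (fun x => f (BondConfig.relabel (sym2Equiv (Site.shift (-x))) ω)) =
          fun x => Pop (BondConfig.relabel (sym2Equiv (Site.shift (-x))) ω)
            (fun z => f (BondConfig.relabel (sym2Equiv (Site.shift (-z)))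
              (BondConfig.relabel (sym2Equiv (Site.shift (-x))) ω))) 0 :=
      fun ω => funext fun x => pop_seen_from hPop f ω x
    have h1 : ∀ ω : BondConfig (Site 3),
        ((Pop ω)^[T + 1] (fun x => f (BondConfig.relabel (sym2Equiv (Site.shift (-x))) ω))) 0 =
          ((Pop ω)^[T] (fun x => Pop (BondConfig.relabel (sym2Equiv (Site.shift (-x))) ω)
            (fun z => f (BondConfig.relabel (sym2Equiv (Site.shift (-z)))
              (BondConfig.relabel (sym2Equiv (Site.shift (-x))) ω))) 0)) 0 := by
      intro ω
      rw [Function.iterate_succ_apply, hstep]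
    simp only [h1]
    rw [ih _ (measurable_pop_zero hPop hf) (pop_zero_mem_Icc hPop hb)]
    simp only [card_mul_pop_zero hPop]
    exact setIntegral_sum_ite f hf hb

end StubStationarity

open StubStationarity in
/-- **Stub `stub_stationarity`** of the crux `VerticalGamblersRuin` (line `registered`, rev 7; exact
registered signature): **stationarity of the degree-biased cluster law under the SRW kernel.**
For every `T : ℕ`, every measurable `f : Ω → [0, 1]` and the unkilled averaging operator `𝒫_ω`
(open-neighbour mean, `0 / 0 = 0`, entering as `Pop` pinned by its formula):
`∫_{0↔∞} deg_ω(0) · (𝒫_ω^[T] (x ↦ f(ω - x)))(0) dP_{p_c} = ∫_{0↔∞} deg_ω(0) · f dP_{p_c}`, where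
`ω - x = BondConfig.relabel (sym2Equiv (Site.shift (-x))) ω` is the configuration seen from `x`
(De Masi–Ferrari–Goldstein–Wick 1989, §4).  Proof: `StubStationarity.setIntegral_card_mul_iterate`
(translation invariance of `P_{p_c}` + "an open edge joins the clusters of its endpoints",
induction on `T`). -/
theorem stub_stationarity :
    ∀ (T : ℕ) (f : BondConfig (Site 3) → ℝ), Measurable f → (∀ ω, 0 ≤ f ω ∧ f ω ≤ 1) →
      ∀ Pop : BondConfig (Site 3) → (Site 3 → ℝ) → Site 3 → ℝ,
        (∀ ω (g : Site 3 → ℝ) (x : Site 3), Pop ω g x =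
          (∑ y ∈ ((zdGraph 3).neighborFinset x).filter (fun y => s(x, y) ∈ ω), g y) /
            ((((zdGraph 3).neighborFinset x).filter (fun y => s(x, y) ∈ ω)).card : ℝ)) →
        ∫ ω in percolatesAt (0 : Site 3),
            ((((zdGraph 3).neighborFinset (0 : Site 3)).filter
                (fun y => s((0 : Site 3), y) ∈ ω)).card : ℝ) *
              ((Pop ω)^[T] (fun x => f (BondConfig.relabel (sym2Equiv (Site.shift (-x))) ω))) 0
            ∂(bondPercolation (zdGraph 3) (criticalProbI 3)) =
          ∫ ω in percolatesAt (0 : Site 3),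
            ((((zdGraph 3).neighborFinset (0 : Site 3)).filter
                (fun y => s((0 : Site 3), y) ∈ ω)).card : ℝ) * f ω
            ∂(bondPercolation (zdGraph 3) (criticalProbI 3)) :=
  fun T f hf hb _ hPop => setIntegral_card_mul_iterate hPop T f hf hb

end Summit.CriticalPhenomena.PercolationContinuityZ3.Theorems.VerticalGamblersRuin
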